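import Summits.AtomisticToContinuum.HydrodynamicLimit.Theorems.StiffCollisionalRelaxationAprioriBoundsFibreCapstones
import Summits.AtomisticToContinuum.HydrodynamicLimit.Theses.UGibbsSRBRigidity
import HarnessLib

/-!
# Line `fibre-deficit-transfer` (crux `AprioriBounds`, stmt-AtomisticToContinuum-14827): the pre-shock far-tail dock and the r5 reduction

Support file (`--supports stmt-AtomisticToContinuum-14827`) of the lead prover of the line (continuation lead c7, cycle 2 of
the line; wave-3 finding of the `stub_farTailAll` worker).  Two additions to the landed capstones
(`…AprioriBoundsFibreCapstones.lean`, lead a1):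

* **The far-tail stub docks to the PRE-SHOCK guarded tail item.**  The registered stub `stub_farTailAll` (skeleton r5:
  `FarTailAllAt` under the crux prefix) was docked by the landed glue `farTailAll_of_gaussianVelocityTails` to
  `SpeedCapSurgery.GaussianVelocityTails` (stmt-9633 = the ALL-HORIZONS body of `HighMomentumCutoff σ`: Gaussian moments along the flow
  for EVERY `T > 0`, no Euler guard — flagged by its refuter review, 2026-08-15T14:48Z, as expected FALSE past an implosion focus).  The crux is a
  PRE-SHOCK statement (`t < T`, classical solution), and the matching tail item exists: `UGibbsSRBRigidity.GaussianTails`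
  (stmt-AtomisticToContinuum-14415, open): Gaussian velocity moments along the flow for `s ∈ [0, t]`, `t < T`, under EXACTLY the crux's
  own prefix (profiles → `∃ σ₀` → classical solution on `[0,T)` → flow family with the `t = 0` LLN).  `farTailAll_of_gaussianTails` docks
  the stub to it VERBATIM through the landed Markov–Tonelli reduction `farTailAll_of_expVelocityMoment` (`η₁ := 1`: no chamber is
  needed for the tails).
* **The r5 composition, importable.**  `partOne_of_linStatL1_farTailAll` and `aprioriBounds_of_r5_stubs` are the skeleton's
  `partOne_of` / `AprioriBounds_of` with the three OPEN r5 stub statements (`stub_linStatL1`, `stub_cellBounds`, `stub_farTailAll`)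
  as hypotheses written out verbatim and the three PROVED r5 stubs (`stub_bracketVanish`, `stub_klLever`, `stub_partOnePrime`, all
  landed) used as theorems — so that any future producer of a stub plugs in with one application (the r2 reduction
  `aprioriBounds_of_stubs` of `…FibreReduction` is stated over the retired rated packages).
* **Capstone 1″** `AprioriBounds_of_KRC_GT_HLPB : KineticRangeControl → UGibbsSRBRigidity.GaussianTails → HydroLimitProfilewiseBand →
  AprioriBounds` (registered sub-goal) and its `AprioriBoundsPreShock` twin: the crux from the three PRE-SHOCK-guarded open items
  9201, 14415, 17372 — every antecedent now lives below the classical Euler horizon, like the crux itself.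

No new definitions; no `sorry`; axioms `propext`, `Classical.choice`, `Quot.sound`.
-/

noncomputable section

open MeasureTheory Filter Set Topology
open scoped ENNReal

namespace Summit.AtomisticToContinuum.HydrodynamicLimit.Theorems.FibreDeficitTransfer

open Literature.MathematicalPhysics.KineticTheory Literature.Analysis.FluidPDE
open Summit.AtomisticToContinuum.HydrodynamicLimit.Theorems.AprioriBoundsNegative (PartOneAt PartTwoAt)
open Summit.AtomisticToContinuum.HydrodynamicLimit.Theorems.VisitLedgerUpscattering (Cfg Flow Flows NiceProfiles)

/-! ## The pre-shock far-tail dock -/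

/-- **`stub_farTailAll` FROM THE PRE-SHOCK TAIL ITEM `UGibbsSRBRigidity.GaussianTails` (stmt-AtomisticToContinuum-14415).**
The guarded Gaussian-moment item carries exactly the crux prefix; for `0 < t < T` it supplies `c > 0`, `C < ⊤`, `N₀` with
`E expVelocityMoment c (Φ_N(s) ·) ≤ C` for `N ≥ N₀`, `s ∈ [0,t]`, and the landed `farTailAll_of_expVelocityMoment` turns this into
`FarTailAllAt σ a₀ θ₀ u₀ Φ t` (`Θ = 1/(2c)`, `A = C.toReal`).  Thresholds: the item's `σ₀`, and `η₁ := 1` (the chamber is not used). -/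
theorem farTailAll_of_gaussianTails :
    Summit.AtomisticToContinuum.HydrodynamicLimit.Theses.UGibbsSRBRigidity.GaussianTails →
    ∀ (a₀ θ₀ : T3 → ℝ) (u₀ : T3 → V3), Continuous a₀ → Continuous θ₀ → Continuous u₀ →
      (∀ x, 0 < a₀ x) → (∀ x, 0 < θ₀ x) →
      ∃ σ₀ : ℝ, 0 < σ₀ ∧ ∃ η₁ : ℝ, 0 < η₁ ∧ ∀ σ : ℝ, 0 < σ → σ < σ₀ →
        ∀ (T : ℝ) (ρ θ : ℝ → T3 → ℝ) (u : ℝ → T3 → V3), IsHardSphereEulerSolution σ T ρ u θ →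
        ∀ Φ : (N : ℕ) → HardSphereFlow (Torus.geometry (Fin 3)) (hsDiameter σ N) (N + 1),
          TendstoHydroFieldsAt (fun N => localGibbsLaw σ a₀ u₀ θ₀ N (Φ N)) Φ ρ u θ 0 →
          ∀ t : ℝ, 0 < t → t < T → (∀ s ∈ Icc 0 t, ∀ x, 2 * ρ s x * σ ^ 3 < η₁) →
            FarTailAllAt σ a₀ θ₀ u₀ Φ t := by
  intro h a₀ θ₀ u₀ ha hθ hu ha0 hθ0
  obtain ⟨σ₀, hσ₀, hb⟩ := h a₀ θ₀ u₀ ha hθ hu ha0 hθ0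
  refine ⟨σ₀, hσ₀, 1, one_pos, fun σ hσ hσlt T ρ θ u hsol Φ hLLN t ht htT _hdil => ?_⟩
  obtain ⟨c, hc, C, hC, N₀, hmom⟩ := hb σ hσ hσlt T ρ θ u hsol Φ hLLN t ⟨ht.le, htT⟩
  exact farTailAll_of_expVelocityMoment hc hC hmom

/-! ## The r5 composition (importable form of the skeleton's `partOne_of` / `AprioriBounds_of`) -/

/-- **Component (i) under the crux prefix from the two OPEN (i)-stubs of skeleton r5** — `stub_linStatL1` (hydrodynamics in the mean on
`[0,t]`) and `stub_farTailAll` (far tails at all levels), written out as hypotheses — with the PROVED r5 stubs `stub_bracketVanish`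
(p134226), `stub_klLever` (p135266), `stub_partOnePrime` (p133823) used as theorems.  Thresholds
`σ₀ := min (min σ₁ σ₃) (min σ₄ (1/2))`, `η₁ := min (min η¹ η³) (min η⁴ η_e)` (`η_e` from `eos_continuousOn`). -/
theorem partOne_of_linStatL1_farTailAll
    (h1 : ∀ (a₀ θ₀ : T3 → ℝ) (u₀ : T3 → V3), Continuous a₀ → Continuous θ₀ → Continuous u₀ → (∀ x, 0 < a₀ x) → (∀ x, 0 < θ₀ x) → ∃ σ₀ : ℝ, 0 < σ₀ ∧ ∃ η₁ : ℝ, 0 < η₁ ∧ ∀ σ : ℝ, 0 < σ → σ < σ₀ → ∀ (T : ℝ) (ρ θ : ℝ → T3 → ℝ) (u : ℝ → T3 → V3), IsHardSphereEulerSolution σ T ρ u θ → ∀ Φ : (N : ℕ) → HardSphereFlow (Torus.geometry (Fin 3)) (hsDiameter σ N) (N + 1), TendstoHydroFieldsAt (fun N => localGibbsLaw σ a₀ u₀ θ₀ N (Φ N)) Φ ρ u θ 0 → ∀ t : ℝ, 0 < t → t < T → (∀ s ∈ Icc 0 t, ∀ x, 2 * ρ s x * σ ^ 3 < η₁) → LinStatL1VanishAt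 σ a₀ θ₀ u₀ ρ θ u Φ t)
    (h4 : ∀ (a₀ θ₀ : T3 → ℝ) (u₀ : T3 → V3), Continuous a₀ → Continuous θ₀ → Continuous u₀ → (∀ x, 0 < a₀ x) → (∀ x, 0 < θ₀ x) → ∃ σ₀ : ℝ, 0 < σ₀ ∧ ∃ η₁ : ℝ, 0 < η₁ ∧ ∀ σ : ℝ, 0 < σ → σ < σ₀ → ∀ (T : ℝ) (ρ θ : ℝ → T3 → ℝ) (u : ℝ → T3 → V3), IsHardSphereEulerSolution σ T ρ u θ → ∀ Φ : (N : ℕ) → HardSphereFlow (Torus.geometry (Fin 3)) (hsDiameter σ N) (N + 1), TendstoHydroFieldsAt (fun N => localGibbsLaw σ a₀ u₀ θ₀ N (Φ N)) Φ ρ u θ 0 → ∀ t : ℝ, 0 < t → t < T → (∀ s ∈ Icc 0 t, ∀ x, 2 * ρ s x * σ ^ 3 < η₁) → FarTailAllAt σ a₀ θ₀ u₀ Φ t) :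
    ∀ (a₀ θ₀ : T3 → ℝ) (u₀ : T3 → V3), Continuous a₀ → Continuous θ₀ → Continuous u₀ →
      (∀ x, 0 < a₀ x) → (∀ x, 0 < θ₀ x) →
      ∃ σ₀ : ℝ, 0 < σ₀ ∧ ∃ η₁ : ℝ, 0 < η₁ ∧ ∀ σ : ℝ, 0 < σ → σ < σ₀ →
        ∀ (T : ℝ) (ρ θ : ℝ → T3 → ℝ) (u : ℝ → T3 → V3), IsHardSphereEulerSolution σ T ρ u θ →
        ∀ Φ : (N : ℕ) → HardSphereFlow (Torus.geometry (Fin 3)) (hsDiameter σ N) (N + 1),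
          TendstoHydroFieldsAt (fun N => localGibbsLaw σ a₀ u₀ θ₀ N (Φ N)) Φ ρ u θ 0 →
          ∀ t : ℝ, 0 < t → t < T → (∀ s ∈ Icc 0 t, ∀ x, 2 * ρ s x * σ ^ 3 < η₁) →
            PartOneAt σ a₀ θ₀ u₀ Φ t := by
  intro a₀ θ₀ u₀ ha hθ hu ha0 hθ0
  have hP : NiceProfiles a₀ θ₀ u₀ := ⟨ha, hθ, hu, ha0, hθ0⟩
  obtain ⟨σ₁, hσ₁, η₁', hη₁', H1⟩ := h1 a₀ θ₀ u₀ ha hθ hu ha0 hθ0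
  obtain ⟨σ₃, hσ₃, η₃', hη₃', H3⟩ := stub_bracketVanish a₀ θ₀ u₀ ha hθ hu ha0 hθ0
  obtain ⟨σ₄, hσ₄, η₄', hη₄', H4⟩ := h4 a₀ θ₀ u₀ ha hθ hu ha0 hθ0
  obtain ⟨ηe, hηe, hfe, hdfe⟩ := eos_continuousOn
  refine ⟨min (min σ₁ σ₃) (min σ₄ (1 / 2)), lt_min (lt_min hσ₁ hσ₃) (lt_min hσ₄ one_half_pos),
    min (min η₁' η₃') (min η₄' ηe), lt_min (lt_min hη₁' hη₃') (lt_min hη₄' hηe), ?_⟩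
  intro σ hσ hσlt T ρ θ u hsol Φ hLLN t ht htT hdil
  simp only [lt_min_iff] at hσlt hdil
  obtain ⟨⟨hs1, hs3⟩, hs4, hshalf⟩ := hσlt
  have hLin : LinStatL1VanishAt σ a₀ θ₀ u₀ ρ θ u Φ t :=
    H1 σ hσ hs1 T ρ θ u hsol Φ hLLN t ht htT (fun s hs x => (hdil s hs x).1.1)
  have hBr : BracketIntegratedVanishAt σ a₀ θ₀ u₀ ρ θ u t :=
    H3 σ hσ hs3 T ρ θ u hsol Φ hLLN t ht htT (fun s hs x => (hdil s hs x).1.2)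
  have hFar : FarTailAllAt σ a₀ θ₀ u₀ Φ t :=
    H4 σ hσ hs4 T ρ θ u hsol Φ hLLN t ht htT (fun s hs x => (hdil s hs x).2.1)
  obtain ⟨hρc, hθc, huc, hθpos, hρpos⟩ := fields_continuousOn hsol htT
  have hcham : ∀ s ∈ Icc 0 t, ∀ x, ρ s x * σ ^ 3 < ηe := fun s hs x => by
    have h := (hdil s hs x).2.2
    have h0 : 0 < ρ s x * σ ^ 3 := mul_pos (hρpos s hs x) (pow_pos hσ 3)
    linarith
  have hΛ := lam0_continuousOn hσ hfe hdfe hρc hθc huc hρpos hθpos hcham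
  have hBulk : IntegratedBulkTailAt σ a₀ θ₀ u₀ Φ t :=
    stub_klLever σ a₀ θ₀ u₀ ρ θ u Φ t hσ hshalf hP ht hρc hθc huc hθpos hΛ hBr hLin
  exact stub_partOnePrime σ a₀ θ₀ u₀ Φ t hσ hshalf.le hP ht hBulk hFar

/-- **THE r5 REDUCTION THEOREM (importable skeleton theorem).**  The three OPEN registered stubs of skeleton r5 — `stub_linStatL1`,
`stub_cellBounds`, `stub_farTailAll`, written out verbatim as hypotheses — imply the crux `StiffCollisionalRelaxation.AprioriBounds` BY NAME;
the proved stubs enter as theorems.  Thresholds: minima of the two components' thresholds. -/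
theorem aprioriBounds_of_r5_stubs
    (h1 : ∀ (a₀ θ₀ : T3 → ℝ) (u₀ : T3 → V3), Continuous a₀ → Continuous θ₀ → Continuous u₀ → (∀ x, 0 < a₀ x) → (∀ x, 0 < θ₀ x) → ∃ σ₀ : ℝ, 0 < σ₀ ∧ ∃ η₁ : ℝ, 0 < η₁ ∧ ∀ σ : ℝ, 0 < σ → σ < σ₀ → ∀ (T : ℝ) (ρ θ : ℝ → T3 → ℝ) (u : ℝ → T3 → V3), IsHardSphereEulerSolution σ T ρ u θ → ∀ Φ : (N : ℕ) → HardSphereFlow (Torus.geometry (Fin 3)) (hsDiameter σ N) (N + 1), TendstoHydroFieldsAt (fun N => localGibbsLaw σ a₀ u₀ θ₀ N (Φ N)) Φ ρ u θ 0 → ∀ t : ℝ, 0 < t → t < T → (∀ s ∈ Icc 0 t, ∀ x, 2 * ρ s x * σ ^ 3 < η₁) → LinStatL1VanishAt σ a₀ θ₀ u₀ ρ θ u Φ t)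
    (h2 : ∀ (a₀ θ₀ : T3 → ℝ) (u₀ : T3 → V3), Continuous a₀ → Continuous θ₀ → Continuous u₀ → (∀ x, 0 < a₀ x) → (∀ x, 0 < θ₀ x) → ∃ σ₀ : ℝ, 0 < σ₀ ∧ ∃ η₁ : ℝ, 0 < η₁ ∧ ∀ σ : ℝ, 0 < σ → σ < σ₀ → ∀ (T : ℝ) (ρ θ : ℝ → T3 → ℝ) (u : ℝ → T3 → V3), IsHardSphereEulerSolution σ T ρ u θ → ∀ Φ : (N : ℕ) → HardSphereFlow (Torus.geometry (Fin 3)) (hsDiameter σ N) (N + 1), TendstoHydroFieldsAt (fun N => localGibbsLaw σ a₀ u₀ θ₀ N (Φ N)) Φ ρ u θ 0 → ∀ t : ℝ, 0 < t → t < T → (∀ s ∈ Icc 0 t, ∀ x, 2 * ρ s x * σ ^ 3 < η₁) → PartTwoAt σ a₀ θ₀ u₀ Φ t)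
    (h4 : ∀ (a₀ θ₀ : T3 → ℝ) (u₀ : T3 → V3), Continuous a₀ → Continuous θ₀ → Continuous u₀ → (∀ x, 0 < a₀ x) → (∀ x, 0 < θ₀ x) → ∃ σ₀ : ℝ, 0 < σ₀ ∧ ∃ η₁ : ℝ, 0 < η₁ ∧ ∀ σ : ℝ, 0 < σ → σ < σ₀ → ∀ (T : ℝ) (ρ θ : ℝ → T3 → ℝ) (u : ℝ → T3 → V3), IsHardSphereEulerSolution σ T ρ u θ → ∀ Φ : (N : ℕ) → HardSphereFlow (Torus.geometry (Fin 3)) (hsDiameter σ N) (N + 1), TendstoHydroFieldsAt (fun N => localGibbsLaw σ a₀ u₀ θ₀ N (Φ N)) Φ ρ u θ 0 → ∀ t : ℝ, 0 < t → t < T → (∀ s ∈ Icc 0 t, ∀ x, 2 * ρ s x * σ ^ 3 < η₁) → FarTailAllAt σ a₀ θ₀ u₀ Φ t) :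
    Summit.AtomisticToContinuum.HydrodynamicLimit.Theses.StiffCollisionalRelaxation.AprioriBounds := by
  rw [AprioriBoundsNegative.aprioriBounds_iff]
  intro a₀ θ₀ u₀ ha hθ hu ha0 hθ0
  obtain ⟨σ₁, hσ₁, η₁', hη₁', HI⟩ := partOne_of_linStatL1_farTailAll h1 h4 a₀ θ₀ u₀ ha hθ hu ha0 hθ0
  obtain ⟨σ₂, hσ₂, η₂', hη₂', HII⟩ := h2 a₀ θ₀ u₀ ha hθ hu ha0 hθ0
  refine ⟨min σ₁ σ₂, lt_min hσ₁ hσ₂, min η₁' η₂', lt_min hη₁' hη₂', ?_⟩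
  intro σ hσ hσlt T ρ θ u hsol Φ hLLN t ht htT hdil
  simp only [lt_min_iff] at hσlt hdil
  exact ⟨HI σ hσ hσlt.1 T ρ θ u hsol Φ hLLN t ht htT (fun s hs x => (hdil s hs x).1),
    HII σ hσ hσlt.2 T ρ θ u hsol Φ hLLN t ht htT (fun s hs x => (hdil s hs x).2)⟩

/-- The `CollisionIsometryCLT` twin of `aprioriBounds_of_r5_stubs` (the two crux decls are one `Prop`). -/
theorem aprioriBoundsPreShock_of_r5_stubs
    (h1 : ∀ (a₀ θ₀ : T3 → ℝ) (u₀ : T3 → V3), Continuous a₀ → Continuous θ₀ → Continuous u₀ → (∀ x, 0 < a₀ x) → (∀ x, 0 < θ₀ x) → ∃ σ₀ : ℝ, 0 < σ₀ ∧ ∃ η₁ : ℝ, 0 < η₁ ∧ ∀ σ : ℝ, 0 < σ → σ < σ₀ → ∀ (T : ℝ) (ρ θ : ℝ → T3 → ℝ) (u : ℝ → T3 → V3), IsHardSphereEulerSolution σ T ρ u θ → ∀ Φ : (N : ℕ) → HardSphereFlow (Torus.geometry (Fin 3)) (hsDiameter σ N) (N + 1), TendstoHydroFieldsAt (fun N =>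 localGibbsLaw σ a₀ u₀ θ₀ N (Φ N)) Φ ρ u θ 0 → ∀ t : ℝ, 0 < t → t < T → (∀ s ∈ Icc 0 t, ∀ x, 2 * ρ s x * σ ^ 3 < η₁) → LinStatL1VanishAt σ a₀ θ₀ u₀ ρ θ u Φ t)
    (h2 : ∀ (a₀ θ₀ : T3 → ℝ) (u₀ : T3 → V3), Continuous a₀ → Continuous θ₀ → Continuous u₀ → (∀ x, 0 < a₀ x) → (∀ x, 0 < θ₀ x) → ∃ σ₀ : ℝ, 0 < σ₀ ∧ ∃ η₁ : ℝ, 0 < η₁ ∧ ∀ σ : ℝ, 0 < σ → σ < σ₀ → ∀ (T : ℝ) (ρ θ : ℝ → T3 → ℝ) (u : ℝ → T3 → V3), IsHardSphereEulerSolution σ T ρ u θ → ∀ Φ : (N : ℕ) → HardSphereFlow (Torus.geometry (Fin 3)) (hsDiameter σ N) (N + 1), TendstoHydroFieldsAt (fun N => localGibbsLaw σ a₀ u₀ θ₀ N (Φ N)) Φ ρ u θ 0 → ∀ t : ℝ, 0 < t → t < T → (∀ s ∈ Icc 0 t, ∀ x, 2 * ρ s x * σ ^ 3 < η₁) → PartTwoAt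 σ a₀ θ₀ u₀ Φ t)
    (h4 : ∀ (a₀ θ₀ : T3 → ℝ) (u₀ : T3 → V3), Continuous a₀ → Continuous θ₀ → Continuous u₀ → (∀ x, 0 < a₀ x) → (∀ x, 0 < θ₀ x) → ∃ σ₀ : ℝ, 0 < σ₀ ∧ ∃ η₁ : ℝ, 0 < η₁ ∧ ∀ σ : ℝ, 0 < σ → σ < σ₀ → ∀ (T : ℝ) (ρ θ : ℝ → T3 → ℝ) (u : ℝ → T3 → V3), IsHardSphereEulerSolution σ T ρ u θ → ∀ Φ : (N : ℕ) → HardSphereFlow (Torus.geometry (Fin 3)) (hsDiameter σ N) (N + 1), TendstoHydroFieldsAt (fun N => localGibbsLaw σ a₀ u₀ θ₀ N (Φ N)) Φ ρ u θ 0 → ∀ t : ℝ, 0 < t → t < T → (∀ s ∈ Icc 0 t, ∀ x, 2 * ρ s x * σ ^ 3 < η₁) → FarTailAllAt σ a₀ θ₀ u₀ Φ t) :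
    Summit.AtomisticToContinuum.HydrodynamicLimit.Theses.CollisionIsometryCLT.AprioriBoundsPreShock :=
  aprioriBounds_of_r5_stubs h1 h2 h4

/-! ## Capstone 1″: every antecedent pre-shock guarded -/

/-- **CAPSTONE 1″ (registered sub-goal `AprioriBounds_of_KRC_GT_HLPB`) — the crux from the three PRE-SHOCK-guarded open items**
`GermanoSplitLES.KineticRangeControl` (stmt-9201: component (ii)), `UGibbsSRBRigidity.GaussianTails` (stmt-14415: Gaussian velocity tails
along the flow below the classical Euler horizon) and `ImplosionDichotomy.HydroLimitProfilewiseBand` (stmt-17372: the profile-wise guarded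
conjunct, giving hydrodynamics in the mean on `[0,t]`), through the landed glues `partTwo_of_kineticRangeControl`,
`farTailAll_of_gaussianTails`, `stub_linStatL1_of_hydroLimitProfilewiseBand` and the r5 reduction. -/
theorem AprioriBounds_of_KRC_GT_HLPB : Summit.AtomisticToContinuum.HydrodynamicLimit.Theses.GermanoSplitLES.KineticRangeControl → Summit.AtomisticToContinuum.HydrodynamicLimit.Theses.UGibbsSRBRigidity.GaussianTails → Summit.AtomisticToContinuum.HydrodynamicLimit.Theses.ImplosionDichotomy.HydroLimitProfilewiseBand → Summit.AtomisticToContinuum.HydrodynamicLimit.Theses.StiffCollisionalRelaxation.AprioriBounds :=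
  fun hKRC hGT hHL => aprioriBounds_of_r5_stubs (stub_linStatL1_of_hydroLimitProfilewiseBand hHL)
    (AdiabatCeiling.partTwo_of_kineticRangeControl hKRC) (farTailAll_of_gaussianTails hGT)

/-- The `CollisionIsometryCLT` twin of `AprioriBounds_of_KRC_GT_HLPB`. -/
theorem AprioriBoundsPreShock_of_KRC_GT_HLPB :
    Summit.AtomisticToContinuum.HydrodynamicLimit.Theses.GermanoSplitLES.KineticRangeControl →
    Summit.AtomisticToContinuum.HydrodynamicLimit.Theses.UGibbsSRBRigidity.GaussianTails →
    Summit.AtomisticToContinuum.HydrodynamicLimit.Theses.ImplosionDichotomy.HydroLimitProfilewiseBand →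
    Summit.AtomisticToContinuum.HydrodynamicLimit.Theses.CollisionIsometryCLT.AprioriBoundsPreShock :=
  AprioriBounds_of_KRC_GT_HLPB

end Summit.AtomisticToContinuum.HydrodynamicLimit.Theorems.FibreDeficitTransfer

end
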